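import Literature.Geometry.Manifold.InverseFunctionTheorem
import HarnessLib

/-!
# The inverse function theorem for maps from a vector space into a manifold

Topic `Geometry/Manifold`. Companion of `Literature/Geometry/Manifold/InverseFunctionTheorem.lean`
(`isLocalDiffeomorphAt_of_mfderiv`: the inverse function theorem for maps between manifolds over
BOUNDARYLESS MODELS, `I.Boundaryless`, `J.Boundaryless`). For the exponential map
`exp_x : T_x M = E → M` of a connection (Lee 2018, Prop. 5.19 (d): "`d(exp_p)_0 = id`, so `exp_p`
is a local diffeomorphism at `0`", by the inverse function theorem, Lee 2013, Thm. 4.5) the source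
is a normed space and the target an arbitrary manifold, possibly modelled on a model with corners
(only `BoundarylessManifold` being assumed downstream); this file proves that case without any
boundarylessness hypothesis on the model of the target:

* `isLocalDiffeomorphAt_of_mfderiv_of_normedSpace` — a map `f : F → M` (`F` complete) of class
  `C^n`, `n ≠ 0`, on an open set containing `a`, whose differential at `a` is a continuous linear
  equivalence `F ≃L E` onto the model space of `M`, is a `C^n` local diffeomorphism at `a`.
  Proof: `g = ψ ∘ f` (`ψ` the extended chart at `f a`) is `C^n` near `a` with invertible derivative
  (the differential of `ψ` at `f a` is invertible); Mathlib's inverse function theorem gives a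
  local homeomorphism `Ψ = g` whose inverse is `C^n` on its target
  (`contDiffOn_symm_of_forall_hasFDerivAt_equiv` of the companion file, after shrinking the source
  to where `Dg` is invertible); the partial diffeomorphism is `ψ⁻¹ ∘ Ψ` with inverse `Ψ⁻¹ ∘ ψ`
  (no openness of `ψ.target` is needed, the source being a vector space).

## References

* J. M. Lee, *Introduction to Smooth Manifolds*, 2nd ed., GTM 218 (2013), Thm. 4.5.
  [LeeSmoothManifolds2013]
-/

noncomputable section

open Set Filter Function Manifold
open scoped Manifold ContDiff Topology

namespace Literature.Geometry.Manifold

variable {E : Type*} [NormedAddCommGroup E] [NormedSpace ℝ E]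
  {F : Type*} [NormedAddCommGroup F] [NormedSpace ℝ F] [CompleteSpace F]
  {H : Type*} [TopologicalSpace H] {I : ModelWithCorners ℝ E H}
  {M : Type*} [TopologicalSpace M] [ChartedSpace H M]
  {n : WithTop ℕ∞} [IsManifold I n M]

/-- **Inverse function theorem, from a vector space into a manifold** (Lee 2013, Thm. 4.5, the
case of a map `f : F → M` out of a complete normed space; no boundarylessness hypothesis on the
model of `M`). If `f` is `C^n`, `n ≠ 0`, on an open set `s ∋ a` and `mfderiv 𝓘(ℝ, F) I f a` is a
continuous linear equivalence `f' : F ≃L[ℝ] E`, then `f` is a `C^n` local diffeomorphism at `a`.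
[cite: LeeSmoothManifolds2013, Thm. 4.5] -/
theorem isLocalDiffeomorphAt_of_mfderiv_of_normedSpace (hn : n ≠ 0) {f : F → M} {a : F}
    {s : Set F} (hs : IsOpen s) (ha : a ∈ s) (hf : ContMDiffOn 𝓘(ℝ, F) I n f s)
    (f' : F ≃L[ℝ] E) (hf' : mfderiv 𝓘(ℝ, F) I f a = (f' : F →L[ℝ] E)) :
    IsLocalDiffeomorphAt 𝓘(ℝ, F) I n f a := by
  have hn1 : (1 : WithTop ℕ∞) ≤ n := ENat.one_le_iff_ne_zero_withTop.2 hn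
  haveI : IsManifold I 1 M := IsManifold.of_le hn1
  set ψ := extChartAt I (f a) with hψ
  -- the open set of good points and the chart expression `g = ψ ∘ f`
  set T : Set F := s ∩ f ⁻¹' ψ.source with hT
  have hTo : IsOpen T := hf.continuousOn.isOpen_inter_preimage hs (isOpen_extChartAt_source (f a))
  have haT : a ∈ T := ⟨ha, mem_extChartAt_source (f a)⟩
  set g : F → E := ψ ∘ f with hg
  have hgTm : ContMDiffOn 𝓘(ℝ, F) 𝓘(ℝ, E) n g T := by
    refine (contMDiffOn_extChartAt (I := I) (n := n) (x := f a)).comp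
      (hf.mono inter_subset_left) fun z hz ↦ ?_
    have h : f z ∈ ψ.source := hz.2
    rwa [hψ, extChartAt_source] at h
  have hgT : ContDiffOn ℝ n g T := contMDiffOn_iff_contDiffOn.1 hgTm
  -- the derivative of `g` at `a` is an equivalence
  have hmd : MDifferentiableAt 𝓘(ℝ, F) I f a :=
    (hf.contMDiffAt (hs.mem_nhds ha)).mdifferentiableAt hn
  have hψd : MDifferentiableAt I 𝓘(ℝ, E) ψ (f a) := mdifferentiableAt_extChartAt (mem_chart_source H (f a))
  obtain ⟨eA, heA⟩ := isInvertible_mfderiv_extChartAt (I := I) (mem_extChartAt_source (f a))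
  have hgx : HasFDerivAt g ((f'.trans eA : F ≃L[ℝ] E) : F →L[ℝ] E) a := by
    have hd : DifferentiableAt ℝ g a :=
      (hgT.differentiableOn hn _ haT).differentiableAt (hTo.mem_nhds haT)
    have h1 : fderiv ℝ g a = mfderiv 𝓘(ℝ, F) 𝓘(ℝ, E) g a := (mfderiv_eq_fderiv).symm
    have h2 : mfderiv 𝓘(ℝ, F) 𝓘(ℝ, E) g a = (mfderiv I 𝓘(ℝ, E) ψ (f a)).comp (mfderiv 𝓘(ℝ, F) I f a) :=
      mfderiv_comp a hψd hmd
    have h3 : ((f'.trans eA : F ≃L[ℝ] E) : F →L[ℝ] E) =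
        (mfderiv I 𝓘(ℝ, E) ψ (f a)).comp (mfderiv 𝓘(ℝ, F) I f a) := by
      rw [hf', ← heA]
      rfl
    rw [h3, ← h2, ← h1]
    exact hd.hasFDerivAt
  -- shrink `T` to where the derivative of `g` is invertible
  set W : Set F := T ∩ (fderiv ℝ g) ⁻¹' range ((↑) : (F ≃L[ℝ] E) → F →L[ℝ] E) with hW
  have hWo : IsOpen W :=
    (hgT.continuousOn_fderiv_of_isOpen hTo hn1).isOpen_inter_preimage hTo
      ContinuousLinearEquiv.isOpen
  have haW : a ∈ W := ⟨haT, ⟨f'.trans eA, hgx.fderiv.symm⟩⟩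
  -- Mathlib's inverse function theorem at `a`, restricted to `W`
  have hgan : ContDiffAt ℝ n g a := hgT.contDiffAt (hTo.mem_nhds haT)
  set Ψ₀ := hgan.toOpenPartialHomeomorph g hgx hn with hΨ₀
  set Ψ := Ψ₀.restrOpen W hWo with hΨ
  have hΨg : ∀ z, Ψ z = g z := fun z ↦ rfl
  have hΨsrc : Ψ.source = Ψ₀.source ∩ W := Ψ₀.restrOpen_source W hWo
  have haΨ : a ∈ Ψ.source := by
    rw [hΨsrc]
    exact ⟨hgan.mem_toOpenPartialHomeomorph_source hgx hn, haW⟩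
  have hΨW : Ψ.source ⊆ W := by rw [hΨsrc]; exact inter_subset_right
  have hΨT : Ψ.source ⊆ T := fun z hz ↦ (hΨW hz).1
  -- the inverse is `C^n` on the target
  have hΨsymm : ContDiffOn ℝ n Ψ.symm Ψ.target := by
    refine contDiffOn_symm_of_forall_hasFDerivAt_equiv Ψ (fun z _ ↦ hΨg z) hn
      (fun b hb ↦ hgT.contDiffAt (hTo.mem_nhds (hΨT hb))) fun b hb ↦ ?_
    obtain ⟨e, he⟩ := (hΨW hb).2
    refine ⟨e, ?_⟩
    rw [he]
    exact ((hgT.differentiableOn hn _ (hΨT hb)).differentiableAt (hTo.mem_nhds (hΨT hb))).hasFDerivAt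
  -- the partial equivalence `ψ⁻¹ ∘ Ψ` with inverse `Ψ⁻¹ ∘ ψ`
  set P : PartialEquiv F M := Ψ.toPartialEquiv.trans ψ.symm with hP
  have hPsrc : P.source = Ψ.source := by
    rw [hP, PartialEquiv.trans_source, PartialEquiv.symm_source]
    refine inter_eq_left.2 fun z hz ↦ ?_
    show Ψ z ∈ ψ.target
    rw [hΨg]
    exact ψ.map_source (hΨT hz).2
  have hPtgt : P.target = ψ.source ∩ ψ ⁻¹' Ψ.target := by
    ext y
    simp only [hP, PartialEquiv.trans_target, PartialEquiv.symm_target, mem_inter_iff,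
      mem_preimage]
    constructor
    · rintro ⟨hy, hy'⟩
      exact ⟨hy, by simpa using hy'⟩
    · rintro ⟨hy, hy'⟩
      exact ⟨hy, by simpa using hy'⟩
  have hPo_src : IsOpen P.source := by
    rw [hPsrc]
    exact Ψ.open_source
  have hPo_tgt : IsOpen P.target := by
    rw [hPtgt]
    exact (continuousOn_extChartAt (f a)).isOpen_inter_preimage (isOpen_extChartAt_source (f a))
      Ψ.open_target
  -- on its source `P` is `f`
  have hPf : EqOn f P P.source := by
    intro z hz
    rw [hPsrc] at hz
    have h2 : f z ∈ ψ.source := (hΨT hz).2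
    show f z = ψ.symm (Ψ z)
    rw [hΨg, hg]
    simp only [comp_apply]
    rw [ψ.left_inv h2]
  -- smoothness of `P` and of its inverse
  have hP₁ : ContMDiffOn 𝓘(ℝ, F) I n P P.source := by
    rw [hPsrc]
    exact (hf.mono fun z hz ↦ (hΨT hz).1).congr fun z hz ↦ (hPf (hPsrc.symm ▸ hz)).symm
  have hP₂ : ContMDiffOn I 𝓘(ℝ, F) n P.symm P.target := by
    have hc₁ : ContMDiffOn I 𝓘(ℝ, E) n ψ ψ.source := by
      rw [hψ, extChartAt_source]
      exact contMDiffOn_extChartAt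
    have hc₂ : ContMDiffOn 𝓘(ℝ, E) 𝓘(ℝ, F) n Ψ.symm Ψ.target := contMDiffOn_iff_contDiffOn.2 hΨsymm
    have hcomp : ContMDiffOn I 𝓘(ℝ, F) n (Ψ.symm ∘ ψ) P.target := by
      rw [hPtgt]
      exact hc₂.comp (hc₁.mono inter_subset_left) fun y hy ↦ hy.2
    exact hcomp.congr fun y _ ↦ rfl
  let Φ : PartialDiffeomorph 𝓘(ℝ, F) I F M n :=
    { toPartialEquiv := P
      open_source := hPo_src
      open_target := hPo_tgt
      contMDiffOn_toFun := hP₁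
      contMDiffOn_invFun := hP₂ }
  refine ⟨Φ, ?_, hPf⟩
  show a ∈ P.source
  rw [hPsrc]
  exact haΨ

end Literature.Geometry.Manifold
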